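import Summits.QuantumFields.YangMills.Theorems.AlphaInputsT3ACv2
import Literature.MathematicalPhysics.QuantumFieldTheory.Balaban1983to89.T3Thresholds
import HarnessLib

/-!
# `AlphaInputsT3ACv3ThetaWindow` — (FL-θ): **ON THE RECORD'S COUPLING WINDOW `γ ≤ (min γ₀ 1)²` EVERY THRESHOLD `θ(L, γ, b₀, p₀; i)` IS BELOW `1/(16·L²·B₃·Z_full)`**, hence the
# (40)-window `ε_W = 2L²·avgWindowFactor·θ` of the (FL) row is below `avgWindowFactor/(8·B₃·Z_full)` — the arithmetic letter the final `hLift` knit (MAP M22) discharges its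
# `(hε : ε′ ≤ ε_FL)` binder with — lane `pub-balaban3d` ∕ cell `ym3-torus`, seat alpha-2 (g6); ★★OWNER ym3-torus-plan g25 RULING (FL-SMALL) 03:29:46Z

WHY.  The group's threshold is `γ₀ = gammaMin [γ₂₈, γ₄₆, γ_OO, γ₇₁] ≤ γ₄₆ = gammaOf b₀ p₀ σ₄₆`, `σ₄₆ = 1/(2·(8L²·B₃·Z_full))`, `gammaOf b₀ p₀ σ = min 1 (σ/(b₀·Q₀(p₀)))²`
(`Proofs.Primitives`, `Proofs.Thresholds`); and `T3Thresholds.θBal_le_of_le_gamma` says `γ ≤ ((σ/(b₀Q₀))²)² ⇒ θ(i) ≤ σ` for every `i`.  So on the record's window the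
thresholds are uniformly `≤ σ₄₆`, for EVERY level `i` — no new constant, no registry edit.
WHAT (def-free).  ★ `theta_le_sigma46_of_window` (`θBal L γ 𝔠.b₀ 𝔠.p₀ i ≤ 1/(2·(8L²·𝔠.B₃·𝔠.Zfull))`), `theta_le_of_window'` (the same as `1/(16·L²·B₃·Z_full)`),
★ `window_le_of_window` (`2L²·avgWindowFactor L·θ(i) ≤ avgWindowFactor L/(8·B₃·Z_full)`).
HONEST FRAMING.  Real arithmetic on the record's thresholds; count-neutral helper toward the (FL) row `hLift` of R3 2′∕2′χ (`stub_laneRecordsV3`, items 19935∕19936 — NOT proved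
here); registry untouched; nothing about d = 4, the continuum, or a mass gap; YM₃ on T³ is rung R3, not the Clay problem.

References: T. Bałaban, Commun. Math. Phys. 102 (1985) 255–275 [Balaban1985UV3] ((7) p.257, (45) p.267, p.256 L15–18).
-/

set_option autoImplicit false

noncomputable section

namespace Summit.QuantumFields.YangMills.Theorems.ThetaWindow

open Literature.MathematicalPhysics.QuantumFieldTheory.Balaban1983to89
open Literature.MathematicalPhysics.QuantumFieldTheory.Balaban1983to89.T3UnitScaleTilt (θBal)
open Literature.MathematicalPhysics.QuantumFieldTheory.Balaban1983to89.T3Thresholds (θBal_le_of_le_gamma)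
open Summit.QuantumFields.Balaban3D.Proofs.Constants (gammaMin gammaMin_le)
open Summit.QuantumFields.Balaban3D.Proofs.Thresholds (gammaOf Q0 Q0_pos)
open Summit.QuantumFields.Balaban3D.Proofs.Primitives (AlphaConsts)

variable {L N : ℕ}

/-- **★ (FL-θ)**: on the record's coupling window `0 < γ ≤ (min γ₀ 1)²` every threshold is below the (45)-constant: `θ(L, γ, b₀, p₀; i) ≤ 1/(2·(8L²·B₃·Z_full))` for EVERY `i`
(`γ₀ ≤ γ₄₆ = gammaOf b₀ p₀ σ₄₆ ≤ (σ₄₆/(b₀Q₀))²`, so `γ ≤ γ₀² ≤ ((σ₄₆/(b₀Q₀))²)²`, then `θBal_le_of_le_gamma`). [cite: Balaban1985UV3, (7) p.257, (45) p.267] -/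
theorem theta_le_sigma46_of_window (𝔠 : AlphaConsts L N) {γ : ℝ} (hγ : 0 < γ) (hγ1 : γ ≤ (min 𝔠.gamma0 1) ^ 2) (i : ℕ) :
    θBal L γ 𝔠.b₀ 𝔠.p₀ i ≤ 1 / (2 * (8 * (L : ℝ) ^ 2 * 𝔠.B₃ * 𝔠.Zfull)) := by
  set σ : ℝ := 1 / (2 * (8 * (L : ℝ) ^ 2 * 𝔠.B₃ * 𝔠.Zfull)) with hσ_def
  have hL1 : 1 ≤ L := 𝔠.one_lt_L.le
  have hLpos : (0 : ℝ) < L := by exact_mod_cast (show 0 < L by omega)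
  have hσ : 0 ≤ σ := by
    have := 𝔠.B₃_pos; have := 𝔠.Zfull_pos
    rw [hσ_def]; positivity
  have hQ : 0 < 𝔠.b₀ * Q0 𝔠.p₀ := mul_pos 𝔠.b₀_pos (Q0_pos 𝔠.p₀_pos)
  -- `min γ₀ 1 ≤ γ₄₆ ≤ (σ/(b₀Q₀))²`
  have h46 : 𝔠.gamma0 ≤ 𝔠.gamma46 := gammaMin_le (by simp)
  have h46' : 𝔠.gamma46 ≤ (σ / (𝔠.b₀ * Q0 𝔠.p₀)) ^ 2 := by
    show gammaOf 𝔠.b₀ 𝔠.p₀ (1 / (2 * (8 * (L : ℝ) ^ 2 * 𝔠.B₃ * 𝔠.Zfull))) ≤ _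
    unfold gammaOf
    exact min_le_right _ _
  have hmin0 : 0 ≤ min 𝔠.gamma0 1 := le_min 𝔠.gamma0_pos.le zero_le_one
  have hmin : min 𝔠.gamma0 1 ≤ (σ / (𝔠.b₀ * Q0 𝔠.p₀)) ^ 2 := (min_le_left _ _).trans (h46.trans h46')
  have hγσ : γ ≤ ((σ / (𝔠.b₀ * Q0 𝔠.p₀)) ^ 2) ^ 2 :=
    hγ1.trans (pow_le_pow_left₀ hmin0 hmin 2)
  have hγone : γ ≤ 1 := hγ1.trans (by nlinarith [min_le_right 𝔠.gamma0 1, hmin0])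
  exact θBal_le_of_le_gamma hL1 𝔠.b₀_pos 𝔠.p₀_pos hσ hγ hγone hγσ i

/-- The same bound written as `1/(16·L²·B₃·Z_full)`. [cite: Balaban1985UV3, (45) p.267] -/
theorem theta_le_of_window' (𝔠 : AlphaConsts L N) {γ : ℝ} (hγ : 0 < γ) (hγ1 : γ ≤ (min 𝔠.gamma0 1) ^ 2) (i : ℕ) :
    θBal L γ 𝔠.b₀ 𝔠.p₀ i ≤ 1 / (16 * (L : ℝ) ^ 2 * 𝔠.B₃ * 𝔠.Zfull) := by
  have h := theta_le_sigma46_of_window 𝔠 hγ hγ1 i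
  have e : 2 * (8 * (L : ℝ) ^ 2 * 𝔠.B₃ * 𝔠.Zfull) = 16 * (L : ℝ) ^ 2 * 𝔠.B₃ * 𝔠.Zfull := by ring
  rwa [e] at h

/-- **★ THE (40)-WINDOW ON THE RECORD'S COUPLING WINDOW**: `ε_W(i) = 2L²·avgWindowFactor L·θ(i) ≤ avgWindowFactor L/(8·B₃·Z_full)` for every `i` — the numeral the final `hLift`
knit compares with `ε_FL` (choose `B₃ ≥ avgWindowFactor L/(8·Z_full·ε_FL)` at the record's construction). [cite: Balaban1985UV3, (7) p.257, (40) p.266, (45) p.267] -/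
theorem window_le_of_window (𝔠 : AlphaConsts L N) {γ : ℝ} (hγ : 0 < γ) (hγ1 : γ ≤ (min 𝔠.gamma0 1) ^ 2) (i : ℕ) :
    2 * (L : ℝ) ^ 2 * avgWindowFactor L * θBal L γ 𝔠.b₀ 𝔠.p₀ i ≤ avgWindowFactor L / (8 * 𝔠.B₃ * 𝔠.Zfull) := by
  have hL1 : 1 ≤ L := 𝔠.one_lt_L.le
  have hLpos : (0 : ℝ) < L := by exact_mod_cast (show 0 < L by omega)
  have hB := 𝔠.B₃_pos; have hZ := 𝔠.Zfull_pos
  have hA : 0 ≤ avgWindowFactor L := by unfold avgWindowFactor; positivity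
  have h := theta_le_of_window' 𝔠 hγ hγ1 i
  calc 2 * (L : ℝ) ^ 2 * avgWindowFactor L * θBal L γ 𝔠.b₀ 𝔠.p₀ i
      ≤ 2 * (L : ℝ) ^ 2 * avgWindowFactor L * (1 / (16 * (L : ℝ) ^ 2 * 𝔠.B₃ * 𝔠.Zfull)) :=
        mul_le_mul_of_nonneg_left h (by positivity)
    _ = avgWindowFactor L / (8 * 𝔠.B₃ * 𝔠.Zfull) := by field_simp; ring

end Summit.QuantumFields.YangMills.Theorems.ThetaWindow

end
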